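import Summits.BirchSwinnertonDyer.BirchSwinnertonDyer.Theorems.TameQuarticSolventSolventPairLowerBoundTwistTprime
import HarnessLib

/-!
# Route `KatoDescentTamePotSupersingular` (rung K8, sub-rung B4 (t′), cell `bsd-potss`): a kernel TOOL for the per-row records —
# the census cell (t′) `SubTprime W 3` at `p = 3` (Kodaira `III` / `III*`) read off an INTEGER model by Tate's algorithm
# (seat `bsd-potss-k8t-c4` g15; route-free; 0 definitions, 0 named facts, 0 `sorry`; closes nothing)

WHY. The U₀-ns rows of items 19202 / 19982 are (t′) rows `SubTprime W p` (`¬ PotMult ∧ f_p = 2 ∧ e ∤ p − 1`). At `p ≥ 5` the cell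
is read off `(ord_p j, ord_p Δ_min)` (g14 tool `subTprime_of_intModel`). At `p = 3` the conductor exponent is NOT automatic; the
tree's dictionary `Additive.subTprime_three_iff_kodairaSymbolAt_III_or_IIIstar` says (t′) at `3` IS Kodaira `III` or `III*`, and
the tree's forward evaluations of Tate's algorithm (`TateAlgorithm.kodairaSymbolOfMinimal_eq_III_of_step2`,
`…_eq_IIIstar_of_step9`) certify those symbols from DIVISIBILITIES of the coefficients of a Step-2 / Step-9 normalised model.
This file packages the three steps for a curve `W/ℚ` given with an INTEGER model `N` and a rational change of variables `C`
with `C • W = N` and `3¹² ∤ Δ(N)` (so `N` is minimal at `3` and Tate's algorithm may be run on `N ⊗ ℤ₃`,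
`SolventPairLowerBound.kodairaSymbolAt_placeOf_three_eq_of_model`):
* `kodairaSymbolAt_three_eq_of_intModel` — the census symbol `W.kodairaSymbolAt (placeOf 3)` is Tate's algorithm on `N ⊗ ℤ₃`;
* `kodairaSymbolAt_three_eq_III_of_intModel` — `3 ∣ a₃, a₄, b₂`, `9 ∣ a₆`, `27 ∤ b₈` on `N` ⟹ symbol `III`;
* `kodairaSymbolAt_three_eq_IIIstar_of_intModel` — `3 ∣ a₁`, `9 ∣ a₂`, `27 ∣ a₃, a₄`, `3⁵ ∣ a₆`, `3⁴ ∤ a₄` on `N` ⟹ symbol `III*`;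
* `subTprime_three_of_intModel_III` / `subTprime_three_of_intModel_IIIstar` — with `Addv W 3`, the census cell (t′) at `3`.
Per row the translation `C = [1, r, s, t]` (integers) is found by running Tate's algorithm modulo `3⁵`; every divisibility is
then a `decide` on integer literals.

References: [SilvermanATAEC1994] IV.9.4 Steps 1–4, 9 and Table 4.1; [SilvermanAEC2009] VII.1 Rem. 1.1, Prop. 1.3(b);
[Delbourgo1998] §1.5.
-/

set_option autoImplicit false
-- the Theorems directory repeats the summit name (sibling precedent `KatoDescentPotSupersingularAssembly.lean`)
set_option linter.dupNamespace false

noncomputable section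

open scoped Classical

namespace Summit.BirchSwinnertonDyer.BirchSwinnertonDyer.Theorems.TameUpperUnitTwistRecords

open WeierstrassCurve IsLocalRing
  Literature.NumberTheory.DiophantineGeometry Literature.NumberTheory.DiophantineGeometry.TateAlgorithm
  Literature.NumberTheory.EllipticCurves Literature.NumberTheory.EllipticCurves.Rank1Residual
  Summit.BirchSwinnertonDyer.Rank1Residual Summit.BirchSwinnertonDyer.Rank1Residual.Additive
  Summit.BirchSwinnertonDyer.BirchSwinnertonDyer.Theorems.SolventPairLowerBound

/-- `3ⁿ ∣ x ↔ ϖⁿ ∣ x` in `ℤ₃` for the tree's chosen uniformiser `ϖ` of Tate's algorithm. [folklore] -/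
private theorem three_pow_dvd_iff' (x : ℤ_[3]) (n : ℕ) :
    (3 : ℤ_[3]) ^ n ∣ x ↔ uniformizer ℤ_[3] ^ n ∣ x := by
  have h3 : Irreducible (3 : ℤ_[3]) := by simpa using PadicInt.irreducible_p (p := 3)
  rw [← mem_maximalIdeal_pow_iff_dvd_of_irreducible h3, mem_maximalIdeal_pow_iff_dvd]

/-- `3 ∣ x ↔ ϖ ∣ x` in `ℤ₃`. [folklore] -/
private theorem three_dvd_iff' (x : ℤ_[3]) : (3 : ℤ_[3]) ∣ x ↔ uniformizer ℤ_[3] ∣ x := by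
  simpa using three_pow_dvd_iff' x 1

/-- `3ⁿ ∣ a` in `ℤ` transported to `ℤ₃` (`PadicInt.pow_p_dvd_int_iff`). [folklore] -/
private theorem cast_pow_dvd_iff (n : ℕ) (a : ℤ) :
    (3 : ℤ_[3]) ^ n ∣ (a : ℤ_[3]) ↔ (3 : ℤ) ^ n ∣ a := by
  have h := PadicInt.pow_p_dvd_int_iff (p := 3) n a
  push_cast at h
  exact h

/-- **The census Kodaira symbol at `3` is Tate's algorithm on a user-supplied INTEGER model.** If `C • W = N` over `ℚ` for an
integer equation `N` with `3¹² ∤ Δ(N)` (hence `Δ(N) ≠ 0` and `N` minimal at `3`, Silverman *AEC* VII.1 Rem. 1.1), then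
`W.kodairaSymbolAt (placeOf 3) = (N ⊗ ℤ₃).kodairaSymbolOfMinimal` (tree reading lemma
`SolventPairLowerBound.kodairaSymbolAt_placeOf_three_eq_of_model`, *AEC* VII.1.3(b)). [cite: SilvermanAEC2009, VII.1 Remark 1.1 and Prop. 1.3(b)] -/
theorem kodairaSymbolAt_three_eq_of_intModel (W : WeierstrassCurve ℚ) [W.IsElliptic]
    (N : WeierstrassCurve ℤ) (C : VariableChange ℚ) (hC : C • W = N.map (Int.castRingHom ℚ))
    (h12 : ¬ (3 : ℤ) ^ 12 ∣ N.Δ) :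
    W.kodairaSymbolAt (placeOf 3) = (N.map (Int.castRingHom ℤ_[3])).kodairaSymbolOfMinimal := by
  set φ : ℚ →+* ℚ_[3] := algebraMap ℚ ℚ_[3] with hφ
  have hN0 : (N.map (Int.castRingHom ℤ_[3])).Δ ≠ 0 := by
    rw [WeierstrassCurve.map_Δ]
    intro h
    have h0 : N.Δ = 0 := (map_eq_zero_iff (Int.castRingHom ℤ_[3]) (RingHom.injective_int _)).mp h
    exact h12 (h0 ▸ dvd_zero _)
  have h12' : ¬ (3 : ℤ_[3]) ^ 12 ∣ (N.map (Int.castRingHom ℤ_[3])).Δ := by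
    rw [WeierstrassCurve.map_Δ]
    exact fun h ↦ h12 ((cast_pow_dvd_iff 12 N.Δ).mp (by simpa using h))
  refine kodairaSymbolAt_placeOf_three_eq_of_model W (N.map (Int.castRingHom ℤ_[3])) ((C.map φ)⁻¹) ?_ hN0 h12'
  -- `W ⊗ ℚ₃ = (C ⊗ ℚ₃)⁻¹ • (N ⊗ ℤ₃ ⊗ ℚ₃)`
  have hmap : (N.map (Int.castRingHom ℤ_[3])).map (algebraMap ℤ_[3] ℚ_[3]) =
      (N.map (Int.castRingHom ℚ)).map φ := by
    rw [WeierstrassCurve.map_map, WeierstrassCurve.map_map]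
    congr 1
  rw [hmap, ← hC, ← WeierstrassCurve.map_variableChange, inv_smul_smul]
  rfl

/-- **Kodaira `III` at `3` from an integer Step-2 model.** If `C • W = N` over `ℚ` with `N` integral, `3¹² ∤ Δ(N)`, `3 ∣ Δ(N)`, and
`N` is Step-2 normalised of type `III` — `3 ∣ a₃, a₄`, `9 ∣ a₆` (singular point of the reduction at the origin, Step 3 passes),
`3 ∣ b₂` (additive), `27 ∤ b₈` (Step 4 fires) — then `W.kodairaSymbolAt (placeOf 3) = III`
(tree `TateAlgorithm.kodairaSymbolOfMinimal_eq_III_of_step2`). [cite: SilvermanATAEC1994, IV.9.4 Steps 1–4 (PDF pp. 344–345)] -/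
theorem kodairaSymbolAt_three_eq_III_of_intModel (W : WeierstrassCurve ℚ) [W.IsElliptic]
    (N : WeierstrassCurve ℤ) (C : VariableChange ℚ) (hC : C • W = N.map (Int.castRingHom ℚ))
    (h12 : ¬ (3 : ℤ) ^ 12 ∣ N.Δ) (hΔ : (3 : ℤ) ∣ N.Δ)
    (n3 : (3 : ℤ) ∣ N.a₃) (n4 : (3 : ℤ) ∣ N.a₄) (n6 : (3 : ℤ) ^ 2 ∣ N.a₆)
    (hb₂ : (3 : ℤ) ∣ N.b₂) (hb₈ : ¬ (3 : ℤ) ^ 3 ∣ N.b₈) :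
    W.kodairaSymbolAt (placeOf 3) = .III := by
  haveI : Finite (ResidueField ℤ_[3]) := Finite.of_equiv _ (PadicInt.residueField (p := 3)).toEquiv.symm
  rw [kodairaSymbolAt_three_eq_of_intModel W N C hC h12]
  set M := N.map (Int.castRingHom ℤ_[3]) with hM
  have c1 : ∀ a : ℤ, (3 : ℤ) ∣ a → uniformizer ℤ_[3] ∣ (a : ℤ_[3]) := fun a h ↦
    (three_dvd_iff' _).mp (by simpa using (cast_pow_dvd_iff 1 a).mpr (by simpa using h))
  have cn : ∀ (n : ℕ) (a : ℤ), (3 : ℤ) ^ n ∣ a → uniformizer ℤ_[3] ^ n ∣ (a : ℤ_[3]) := fun n a h ↦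
    (three_pow_dvd_iff' _ n).mp ((cast_pow_dvd_iff n a).mpr h)
  refine kodairaSymbolOfMinimal_eq_III_of_step2 ?_ ?_ ?_ ?_ ?_ ?_ ?_
  · rw [hM, WeierstrassCurve.map_Δ]; exact c1 _ hΔ
  · rw [hM, WeierstrassCurve.map_a₃]; exact c1 _ n3
  · rw [hM, WeierstrassCurve.map_a₄]; exact c1 _ n4
  · rw [hM, WeierstrassCurve.map_a₆]; exact c1 _ ((dvd_pow_self 3 two_ne_zero).trans n6)
  · rw [hM, WeierstrassCurve.map_b₂]; exact c1 _ hb₂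
  · rw [hM, WeierstrassCurve.map_a₆]; exact cn 2 _ n6
  · rw [hM, WeierstrassCurve.map_b₈, ← three_pow_dvd_iff']
    intro h
    exact hb₈ ((cast_pow_dvd_iff 3 N.b₈).mp (by simpa using h))

/-- **Kodaira `III*` at `3` from an integer Step-9 model.** If `C • W = N` over `ℚ` with `N` integral, `3¹² ∤ Δ(N)`, and `N` is
Step-9 normalised of type `III*` — `3 ∣ a₁`, `9 ∣ a₂`, `27 ∣ a₃`, `27 ∣ a₄`, `3⁵ ∣ a₆` (the Step-6 cubic is `T³`, the Step-8
quadratic is `Y²`) and `3⁴ ∤ a₄` (Step 9 fires) — then `W.kodairaSymbolAt (placeOf 3) = III*`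
(tree `TateAlgorithm.kodairaSymbolOfMinimal_eq_IIIstar_of_step9`). [cite: SilvermanATAEC1994, IV.9.4 Steps 1–9 (PDF pp. 344–346)] -/
theorem kodairaSymbolAt_three_eq_IIIstar_of_intModel (W : WeierstrassCurve ℚ) [W.IsElliptic]
    (N : WeierstrassCurve ℤ) (C : VariableChange ℚ) (hC : C • W = N.map (Int.castRingHom ℚ))
    (h12 : ¬ (3 : ℤ) ^ 12 ∣ N.Δ)
    (g1 : (3 : ℤ) ∣ N.a₁) (g2 : (3 : ℤ) ^ 2 ∣ N.a₂) (g3 : (3 : ℤ) ^ 3 ∣ N.a₃) (g4 : (3 : ℤ) ^ 3 ∣ N.a₄)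
    (g6 : (3 : ℤ) ^ 5 ∣ N.a₆) (h9 : ¬ (3 : ℤ) ^ 4 ∣ N.a₄) :
    W.kodairaSymbolAt (placeOf 3) = .IIIstar := by
  haveI : Finite (ResidueField ℤ_[3]) := Finite.of_equiv _ (PadicInt.residueField (p := 3)).toEquiv.symm
  rw [kodairaSymbolAt_three_eq_of_intModel W N C hC h12]
  set M := N.map (Int.castRingHom ℤ_[3]) with hM
  have c1 : ∀ a : ℤ, (3 : ℤ) ∣ a → uniformizer ℤ_[3] ∣ (a : ℤ_[3]) := fun a h ↦
    (three_dvd_iff' _).mp (by simpa using (cast_pow_dvd_iff 1 a).mpr (by simpa using h))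
  have cn : ∀ (n : ℕ) (a : ℤ), (3 : ℤ) ^ n ∣ a → uniformizer ℤ_[3] ^ n ∣ (a : ℤ_[3]) := fun n a h ↦
    (three_pow_dvd_iff' _ n).mp ((cast_pow_dvd_iff n a).mpr h)
  refine kodairaSymbolOfMinimal_eq_IIIstar_of_step9 ?_ ?_ ?_ ?_ ?_ ?_
  · rw [hM, WeierstrassCurve.map_a₁]; exact c1 _ g1
  · rw [hM, WeierstrassCurve.map_a₂]; exact cn 2 _ g2
  · rw [hM, WeierstrassCurve.map_a₃]; exact cn 3 _ g3
  · rw [hM, WeierstrassCurve.map_a₄]; exact cn 3 _ g4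
  · rw [hM, WeierstrassCurve.map_a₆]; exact cn 5 _ g6
  · rw [hM, WeierstrassCurve.map_a₄, ← three_pow_dvd_iff']
    intro h
    exact h9 ((cast_pow_dvd_iff 4 N.a₄).mp (by simpa using h))

/-- **The (t′) cell `SubTprime W 3` from an integer Step-2 model of type `III`.** For `W/ℚ` globally minimal with additive
reduction at `3` (`hadd`), an integer model `N` with `C • W = N`, `3¹² ∤ Δ(N)` and the Step-2 divisibilities of type `III`
(`3 ∣ Δ, a₃, a₄, b₂`, `9 ∣ a₆`, `27 ∤ b₈`), the pair `(W, 3)` lies on the census cell (t′) — not potentially multiplicative,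
`f₃ = 2`, `e = 4 ∤ 2` — by the dictionary `Additive.subTprime_three_iff_kodairaSymbolAt_III_or_IIIstar`.
[cite: SilvermanATAEC1994, IV.9.4 Steps 1–4 and Table 4.1 (PDF pp. 344–345, 365)] [cite: Delbourgo1998, §1.5] -/
theorem subTprime_three_of_intModel_III {W : WeierstrassCurve ℚ} [W.IsElliptic] [W.IsGloballyMinimal]
    (hadd : Addv W 3) (N : WeierstrassCurve ℤ) (C : VariableChange ℚ) (hC : C • W = N.map (Int.castRingHom ℚ))
    (h12 : ¬ (3 : ℤ) ^ 12 ∣ N.Δ) (hΔ : (3 : ℤ) ∣ N.Δ)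
    (n3 : (3 : ℤ) ∣ N.a₃) (n4 : (3 : ℤ) ∣ N.a₄) (n6 : (3 : ℤ) ^ 2 ∣ N.a₆)
    (hb₂ : (3 : ℤ) ∣ N.b₂) (hb₈ : ¬ (3 : ℤ) ^ 3 ∣ N.b₈) :
    SubTprime W 3 :=
  (subTprime_three_iff_kodairaSymbolAt_III_or_IIIstar W hadd).mpr
    (Or.inl (kodairaSymbolAt_three_eq_III_of_intModel W N C hC h12 hΔ n3 n4 n6 hb₂ hb₈))

/-- **The (t′) cell `SubTprime W 3` from an integer Step-9 model of type `III*`.** As `subTprime_three_of_intModel_III` with the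
Step-9 divisibilities of type `III*` (`3 ∣ a₁`, `9 ∣ a₂`, `27 ∣ a₃, a₄`, `3⁵ ∣ a₆`, `3⁴ ∤ a₄`).
[cite: SilvermanATAEC1994, IV.9.4 Steps 1–9 and Table 4.1 (PDF pp. 344–346, 365)] [cite: Delbourgo1998, §1.5] -/
theorem subTprime_three_of_intModel_IIIstar {W : WeierstrassCurve ℚ} [W.IsElliptic] [W.IsGloballyMinimal]
    (hadd : Addv W 3) (N : WeierstrassCurve ℤ) (C : VariableChange ℚ) (hC : C • W = N.map (Int.castRingHom ℚ))
    (h12 : ¬ (3 : ℤ) ^ 12 ∣ N.Δ)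
    (g1 : (3 : ℤ) ∣ N.a₁) (g2 : (3 : ℤ) ^ 2 ∣ N.a₂) (g3 : (3 : ℤ) ^ 3 ∣ N.a₃) (g4 : (3 : ℤ) ^ 3 ∣ N.a₄)
    (g6 : (3 : ℤ) ^ 5 ∣ N.a₆) (h9 : ¬ (3 : ℤ) ^ 4 ∣ N.a₄) :
    SubTprime W 3 :=
  (subTprime_three_iff_kodairaSymbolAt_III_or_IIIstar W hadd).mpr
    (Or.inr (kodairaSymbolAt_three_eq_IIIstar_of_intModel W N C hC h12 g1 g2 g3 g4 g6 h9))

end Summit.BirchSwinnertonDyer.BirchSwinnertonDyer.Theorems.TameUpperUnitTwistRecords
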